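import Summits.Ventures.CertifiedQuantumChemistry.Rows.ExactLDLDecision

/-!
# Ventures/CertifiedQuantumChemistry — Rows/ExactLDLRank.lean: the `rank` the exact `LDLᵀ` reader prints
# is the rank (number of accepted positive pivots = rank of a positive semidefinite matrix)

HONEST FRAMING (verbatim): certified bounds for a stated model Hamiltonian in a stated basis; not a
claim about the real molecule beyond that model. Nothing in this file asserts a value, a row or a claim
node about anything.

Seat rdm-B (gen 31), zero compute. Sequel of `Rows/ExactLDLDecision.lean` (same gen), which types the
VERDICT of the block test `ldl_psd` of the exact enclosure checker of record
(`code/qchem_rdm_b/check_enclosure.py`; also `ldl_psd_rat` of the twin `check_enclosure_sym.py`) as the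
decision `ExactLDL.ldlAccept n M = true ↔ M.PosSemidef`. The routine returns a SECOND number, printed in
every transcript of record as `rank` (e.g. `block G_0 dim 128 PSD True rank 120`, `ab-files/v48/`): the
count of accepted POSITIVE pivots (`rank += 1` in the `d > 0` branch; a skipped zero pivot adds nothing; on
rejection the count so far is printed; the twin prints the same counter per reduced block). Those numbers
are read as words of record — 'max-rank anchor' (a Slater point of the face), 'structural kernel of
dimension `dim − rank`'. THIS file types them, block by block (the twin's bookkeeping ACROSS its reduced
blocks — a sum over isotypic components, halved types counted twice — is rank additivity over a
`B`-invariant direct sum and is not restated here):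

* §1 (any field, ANY square matrix — no symmetry, no sign) the linear algebra of one step:
  `finrank_ker_eq_schur` — at a NON-ZERO pivot `x ↦ tail x` is an isomorphism `ker M ≃ ker S` onto the
  kernel of the Schur step (inverse `y ↦ (−(r·y)/d, y)`), so `rank M = rank S + 1`
  (`rank_eq_rank_schur_add_one`, by rank–nullity `rank_add_finrank_ker`); `finrank_ker_eq_minor_add_one` —
  at a ZERO pivot whose row and column vanish, `ker M ≃ K × ker M[succ,succ]`, so
  `rank M = rank M[succ,succ]` (`rank_eq_rank_minor`); `rank_fin_zero`.
* §2 `ldlRank` — the counter, by the same structural recursion as `ldlAccept` (it reproduces the printed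
  number in EVERY case, accepted or not: `0` below a rejecting pivot, `+1` per accepted positive pivot,
  nothing at a skipped zero pivot), and the **RANK THEOREM** `ldlRank_eq_rank`: for a positive
  semidefinite matrix over a linearly ordered field (trivial star), `ldlRank n M = M.rank`; corollary
  `finrank_ker_eq_sub_ldlRank`: `dim ker M = n − (printed rank)` — the structural-kernel count read off a
  transcript. The induction takes the branches of `Rows/ExactLDLDecision.lean` (a PSD matrix has no
  negative pivot; at a zero pivot its column vanishes and the minor is PSD; at a positive pivot the Schur
  step is PSD), which is why this file imports it.
* §3 kernel-checked examples (`decide +kernel`).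

NOT here: the rank printed for a REJECTED matrix means nothing beyond 'positive pivots met before the
rejection' and no theorem is stated about it; ranks over `ℝ` of the cast of a rational matrix equal the
rational ranks (rank is invariant under field extension) — not needed by any word of record and not typed.
References (docstring-only): rank additivity of the Schur complement (Guttman 1946; Zhang (ed.), *The Schur
Complement and Its Applications*, Springer 2005, §0.8 / Thm 1.6 'Guttman rank additivity formula') — here
in the one-pivot form, proved directly by the kernel isomorphism; folklore.
-/

namespace Summit.Ventures.CertifiedQuantumChemistry

open Matrix Module Finset

namespace ExactLDL

/-! ### §1 One elimination step and the kernel (any field, any square matrix) -/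

section RankLemmas

variable {K : Type*} [Field K]

/-- `M *ᵥ x` peeled at index `0`: `(M (t, y))_i = M i 0 · t + Σ_j M i j⁺ y_j`. [folklore] -/
theorem mulVec_cons_apply {n : ℕ} (M : Matrix (Fin (n + 1)) (Fin (n + 1)) K) (t : K) (y : Fin n → K)
    (i : Fin (n + 1)) : (M *ᵥ Fin.cons t y) i = M i 0 * t + ∑ j, M i j.succ * y j := by
  simp [mulVec, dotProduct, Fin.sum_univ_succ]

/-- The Schur step applied to a vector: `(S y)_i = Σ_j M i⁺ j⁺ y_j − (M i⁺ 0 / d) · Σ_j M 0 j⁺ y_j`. [folklore] -/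
theorem schur_mulVec_apply {n : ℕ} (M : Matrix (Fin (n + 1)) (Fin (n + 1)) K) (y : Fin n → K) (i : Fin n) :
    ((Matrix.of fun i j : Fin n => M i.succ j.succ - M i.succ 0 / M 0 0 * M 0 j.succ) *ᵥ y) i =
      ∑ j, M i.succ j.succ * y j - M i.succ 0 / M 0 0 * ∑ j, M 0 j.succ * y j := by
  simp [mulVec, dotProduct, sub_mul, Finset.sum_sub_distrib, Finset.mul_sum, mul_assoc]

/-- Rank–nullity for a square matrix on `Fin n`: `rank M + dim ker M = n` (Mathlib's `Matrix.rank` is the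
dimension of the range of `M.mulVecLin`). [folklore] -/
theorem rank_add_finrank_ker {n : ℕ} (M : Matrix (Fin n) (Fin n) K) :
    M.rank + finrank K (LinearMap.ker M.mulVecLin) = n := by
  rw [Matrix.rank, LinearMap.finrank_range_add_finrank_ker]
  simp

/-- **Non-zero pivot: the kernel survives the Schur step.** For ANY square `M` with `d = M 0 0 ≠ 0` (no
symmetry, no sign), `x ↦ tail x` is a linear isomorphism `ker M ≃ ker S` onto the kernel of the Schur step
`S i j = M i⁺ j⁺ − (M i⁺ 0 / d) M 0 j⁺`, with inverse `y ↦ (−(r·y)/d, y)`, `r` the pivot row; hence the two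
kernels have the same dimension. [folklore] -/
theorem finrank_ker_eq_schur {n : ℕ} (M : Matrix (Fin (n + 1)) (Fin (n + 1)) K) (hd : M 0 0 ≠ 0) :
    finrank K (LinearMap.ker M.mulVecLin) =
      finrank K (LinearMap.ker
        (Matrix.of fun i j : Fin n => M i.succ j.succ - M i.succ 0 / M 0 0 * M 0 j.succ).mulVecLin) := by
  set S : Matrix (Fin n) (Fin n) K :=
    Matrix.of fun i j : Fin n => M i.succ j.succ - M i.succ 0 / M 0 0 * M 0 j.succ with hS
  -- the map ker M → ker S, x ↦ tail x, and its inverse y ↦ (−(r·y)/d, y)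
  have key1 : ∀ x : Fin (n + 1) → K, M *ᵥ x = 0 →
      x 0 = -(∑ j : Fin n, M 0 j.succ * x j.succ) / M 0 0 ∧ S *ᵥ Fin.tail x = 0 := by
    intro x hx
    have h0 := congrFun hx 0
    rw [← Fin.cons_self_tail x, mulVec_cons_apply, Pi.zero_apply] at h0
    have hx0 : x 0 = -(∑ j : Fin n, M 0 j.succ * x j.succ) / M 0 0 := by
      rw [eq_div_iff hd]
      have : M 0 0 * x 0 = -(∑ j, M 0 j.succ * Fin.tail x j) := by linear_combination h0
      simpa [Fin.tail, mul_comm] using this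
    refine ⟨hx0, ?_⟩
    funext i
    have hi := congrFun hx i.succ
    rw [← Fin.cons_self_tail x, mulVec_cons_apply, Pi.zero_apply] at hi
    rw [hS, schur_mulVec_apply, Pi.zero_apply]
    simp only [Fin.tail] at hi ⊢
    rw [hx0] at hi
    field_simp at hi
    -- hi : -(M i⁺ 0 * Σ) + d * Σ' = 0  (shape may vary)
    field_simp
    linear_combination hi
  have key2 : ∀ y : Fin n → K, S *ᵥ y = 0 →
      M *ᵥ Fin.cons (-(∑ j, M 0 j.succ * y j) / M 0 0) y = 0 := by
    intro y hy
    funext i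
    rw [mulVec_cons_apply, Pi.zero_apply]
    refine Fin.cases ?_ (fun i => ?_) i
    · field_simp
      ring
    · have hi := congrFun hy i
      rw [hS, schur_mulVec_apply, Pi.zero_apply] at hi
      field_simp at hi
      field_simp
      linear_combination hi
  refine LinearEquiv.finrank_eq
    { toFun := fun x => ⟨Fin.tail x.1, by
        rw [LinearMap.mem_ker, mulVecLin_apply]; exact (key1 x.1 (by simpa only [LinearMap.mem_ker, mulVecLin_apply] using x.2)).2⟩
      map_add' := fun x y => by ext i; simp [Fin.tail]
      map_smul' := fun c x => by ext i; simp [Fin.tail]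
      invFun := fun y => ⟨Fin.cons (-(∑ j, M 0 j.succ * y.1 j) / M 0 0) y.1, by
        rw [LinearMap.mem_ker, mulVecLin_apply]; exact key2 y.1 (by simpa only [LinearMap.mem_ker, mulVecLin_apply] using y.2)⟩
      left_inv := fun x => by
        apply Subtype.ext
        simp only
        conv_rhs => rw [← Fin.cons_self_tail x.1]
        congr 1
        exact ((key1 x.1 (by simpa only [LinearMap.mem_ker, mulVecLin_apply] using x.2)).1).symm
      right_inv := fun y => by
        apply Subtype.ext
        simp }

/-- **Rank step at a non-zero pivot**: `rank M = rank S + 1` (rank–nullity on both sides of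
`finrank_ker_eq_schur`). This is the `rank += 1` of the reader at an accepted positive pivot. [folklore] -/
theorem rank_eq_rank_schur_add_one {n : ℕ} (M : Matrix (Fin (n + 1)) (Fin (n + 1)) K) (hd : M 0 0 ≠ 0) :
    M.rank = (Matrix.of fun i j : Fin n => M i.succ j.succ - M i.succ 0 / M 0 0 * M 0 j.succ).rank + 1 := by
  have h1 := rank_add_finrank_ker M
  have h2 := rank_add_finrank_ker
    (Matrix.of fun i j : Fin n => M i.succ j.succ - M i.succ 0 / M 0 0 * M 0 j.succ)
  rw [finrank_ker_eq_schur M hd] at h1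
  omega

/-- **Zero pivot with vanishing row and column: the kernel gains exactly the pivot direction.**
`ker M ≃ K × ker M[succ, succ]` via `x ↦ (x 0, tail x)`, so `dim ker M = dim ker M[succ,succ] + 1`. [folklore] -/
theorem finrank_ker_eq_minor_add_one {n : ℕ} (M : Matrix (Fin (n + 1)) (Fin (n + 1)) K) (h0 : M 0 0 = 0)
    (hr : ∀ j : Fin n, M 0 j.succ = 0) (hc : ∀ i : Fin n, M i.succ 0 = 0) :
    finrank K (LinearMap.ker M.mulVecLin) =
      finrank K (LinearMap.ker (M.submatrix Fin.succ Fin.succ).mulVecLin) + 1 := by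
  set D := M.submatrix Fin.succ Fin.succ with hD
  have key : ∀ x : Fin (n + 1) → K, M *ᵥ x = 0 ↔ D *ᵥ Fin.tail x = 0 := by
    intro x
    constructor
    · intro hx
      funext i
      have hi := congrFun hx i.succ
      rw [← Fin.cons_self_tail x, mulVec_cons_apply, hc i, zero_mul, zero_add] at hi
      simpa [hD, mulVec, dotProduct] using hi
    · intro hy
      funext i
      rw [← Fin.cons_self_tail x, mulVec_cons_apply, Pi.zero_apply]
      refine Fin.cases ?_ (fun i => ?_) i
      · simp [h0, hr]
      · rw [hc i, zero_mul, zero_add]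
        have := congrFun hy i
        simpa [hD, mulVec, dotProduct] using this
  have e : LinearMap.ker M.mulVecLin ≃ₗ[K] (K × LinearMap.ker D.mulVecLin) :=
    { toFun := fun x => (x.1 0, ⟨Fin.tail x.1, by
        rw [LinearMap.mem_ker, mulVecLin_apply]; exact (key x.1).mp (by simpa only [LinearMap.mem_ker, mulVecLin_apply] using x.2)⟩)
      map_add' := fun x y => by ext <;> simp [Fin.tail]
      map_smul' := fun c x => by ext <;> simp [Fin.tail]
      invFun := fun p => ⟨Fin.cons p.1 p.2.1, by
        rw [LinearMap.mem_ker, mulVecLin_apply]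
        exact (key _).mpr (by simpa only [LinearMap.mem_ker, mulVecLin_apply, Fin.tail_cons] using p.2.2)⟩
      left_inv := fun x => by apply Subtype.ext; simp
      right_inv := fun p => by ext <;> simp }
  rw [e.finrank_eq, Module.finrank_prod, Module.finrank_self]
  ring

/-- **Rank step at a skipped zero pivot**: `rank M = rank M[succ, succ]` — the reader's `continue` without
`rank += 1`. [folklore] -/
theorem rank_eq_rank_minor {n : ℕ} (M : Matrix (Fin (n + 1)) (Fin (n + 1)) K) (h0 : M 0 0 = 0)
    (hr : ∀ j : Fin n, M 0 j.succ = 0) (hc : ∀ i : Fin n, M i.succ 0 = 0) :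
    M.rank = (M.submatrix Fin.succ Fin.succ).rank := by
  have h1 := rank_add_finrank_ker M
  have h2 := rank_add_finrank_ker (M.submatrix Fin.succ Fin.succ)
  rw [finrank_ker_eq_minor_add_one M h0 hr hc] at h1
  omega

/-- The `0 × 0` matrix has rank `0` (the reader's initial `rank = 0`). [folklore] -/
theorem rank_fin_zero (M : Matrix (Fin 0) (Fin 0) K) : M.rank = 0 := by
  have h := rank_add_finrank_ker M
  omega

end RankLemmas

/-! ### §2 The counter and the rank theorem -/

section Counter

variable {K : Type*} [Field K] [LinearOrder K]

/-- **The reader's `rank` counter**, by the structural recursion of `ldlAccept` (peel index `0`): `0` for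
the empty matrix and below a negative pivot; at a zero pivot, the minor's count if the column below
vanishes, else `0`; at a positive pivot, the Schur step's count `+ 1`. This is the number `ldl_psd` prints
as `rank` in every case. [folklore] -/
def ldlRank : (n : ℕ) → Matrix (Fin n) (Fin n) K → ℕ
  | 0, _ => 0
  | n + 1, M =>
    if M 0 0 < 0 then 0
    else if M 0 0 = 0 then
      (if ∀ i : Fin n, M i.succ 0 = 0 then ldlRank n (M.submatrix Fin.succ Fin.succ) else 0)
    else
      ldlRank n (Matrix.of fun i j : Fin n => M i.succ j.succ - M i.succ 0 / M 0 0 * M 0 j.succ) + 1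

/-- Unfolding equation of `ldlRank` at a successor dimension (by `rfl`). [folklore] -/
theorem ldlRank_succ {n : ℕ} (M : Matrix (Fin (n + 1)) (Fin (n + 1)) K) :
    ldlRank (n + 1) M =
      if M 0 0 < 0 then 0
      else if M 0 0 = 0 then
        (if ∀ i : Fin n, M i.succ 0 = 0 then ldlRank n (M.submatrix Fin.succ Fin.succ) else 0)
      else
        ldlRank n (Matrix.of fun i j : Fin n => M i.succ j.succ - M i.succ 0 / M 0 0 * M 0 j.succ)
          + 1 := rfl

variable [IsStrictOrderedRing K] [StarRing K] [TrivialStar K]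

/-- **RANK THEOREM.** For a positive semidefinite matrix over a linearly ordered field (trivial star)
the reader's count of accepted positive pivots IS the rank: `ldlRank n M = M.rank`. Induction on the
dimension through the branches of `Rows/ExactLDLDecision.lean` and the rank steps of §1. [folklore] -/
theorem ldlRank_eq_rank :
    ∀ (n : ℕ) (M : Matrix (Fin n) (Fin n) K), M.PosSemidef → ldlRank n M = M.rank
  | 0, M, _ => by simp [ldlRank, rank_fin_zero]
  | n + 1, M, hM => by
    rw [ldlRank_succ]
    have hnn : ¬ M 0 0 < 0 := not_lt.mpr hM.diag_nonneg
    rw [if_neg hnn]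
    by_cases h0 : M 0 0 = 0
    · obtain ⟨hc, hD⟩ := (posSemidef_iff_of_pivot_eq_zero hM.1 h0).mp hM
      have hr : ∀ j : Fin n, M 0 j.succ = 0 := fun j => by
        rw [← entry_comm_of_isHermitian hM.1, hc j]
      rw [if_pos h0, if_pos hc, ldlRank_eq_rank n _ hD, rank_eq_rank_minor M h0 hr hc]
    · have hd : 0 < M 0 0 := lt_of_le_of_ne (not_lt.mp hnn) (Ne.symm h0)
      have hS := (posSemidef_iff_schur_of_pivot_pos hM.1 hd).mp hM
      rw [if_neg h0, ldlRank_eq_rank n _ hS, rank_eq_rank_schur_add_one M h0]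

/-- **The structural-kernel count read off a transcript**: for a positive semidefinite matrix of dimension
`n` whose printed rank is `r`, `dim ker M = n − r` (e.g. `G_0 dim 128 … rank 120` ⇒ an `8 = L`-dimensional
kernel at `L = 8`). [folklore] -/
theorem finrank_ker_eq_sub_ldlRank {n : ℕ} (M : Matrix (Fin n) (Fin n) K) (hM : M.PosSemidef) :
    finrank K (LinearMap.ker M.mulVecLin) = n - ldlRank n M := by
  have h := rank_add_finrank_ker M
  rw [ldlRank_eq_rank n M hM]
  omega

/-- 'Max-rank' in the words of record: printed rank `= n` iff the kernel is trivial (for a PSD matrix).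
[folklore] -/
theorem ldlRank_eq_iff_ker_eq_bot {n : ℕ} (M : Matrix (Fin n) (Fin n) K) (hM : M.PosSemidef) :
    ldlRank n M = n ↔ LinearMap.ker M.mulVecLin = ⊥ := by
  rw [← Submodule.finrank_eq_zero, finrank_ker_eq_sub_ldlRank M hM]
  have h := rank_add_finrank_ker M
  rw [← ldlRank_eq_rank n M hM] at h
  omega

end Counter

/-! ### §3 Kernel-checked examples -/

section Examples

/-- Zero leading pivot skipped, then a rank-one minor: printed rank `1`. -/
example : ldlRank (K := ℚ) 3 !![0, 0, 0; 0, 1, 1; 0, 1, 1] = 1 := by decide +kernel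

/-- Rank-one `[[1,2],[2,4]]`: one positive pivot, then a zero pivot. -/
example : ldlRank (K := ℚ) 2 !![1, 2; 2, 4] = 1 := by decide +kernel

/-- Full rank (positive definite tridiagonal). -/
example : ldlRank (K := ℚ) 3 !![2, -1, 0; -1, 2, -1; 0, -1, 2] = 3 := by decide +kernel

/-- A rejected matrix: the printed number is the count of positive pivots met BEFORE the rejection
(here `1`), about which nothing is claimed. -/
example : ldlRank (K := ℚ) 2 !![1, 2; 2, 3] = 1 := by decide +kernel

end Examples

end ExactLDL

end Summit.Ventures.CertifiedQuantumChemistry
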